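import Mathlib
import Summits.PneNP.PneNP.Theorems.ConvexRankGatesConvexGateBlindMonoMoment

/-!
# PneNP / ConvexRankGates — `ConvexGateBlind`: variance-sensitive exponential moments of the monochromatic mass

Helpers (`--supports stmt-PneNP-10680`), COLUMN-SPACE line (prover seat 2, session 16): the BERNSTEIN/FREEDMAN-TYPE
sharpening of `…MonoMoment.expMoment_le`. The increment of the monochromatic mass at a freshly exposed vertex `x` is
`A_{c x}` where `A_i = ∑_{u earlier, c u = i} V u x`; since `∑_i |A_i| ≤ deg(x)` AND `|A_i| ≤ deg(x)`, its conditional SECOND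
MOMENT is `≤ (1/q)∑_i A_i² ≤ deg(x)²/q` — a factor `q` smaller than the squared range used by the Hoeffding-type one-step
lemma. With `e^y ≤ 1 + y + y²` this gives

* `sum_exp_le_of_sum_eq_zero_var` — `∑_i y_i = 0`, `|y_i| ≤ 1` ⟹ `∑_i e^{y_i} ≤ q·exp((∑_i y_i²)/q)`;
* `expMoment_le_var` — `∑_c exp(λ·(M(univ,c) − M(H,c) − (mass(univ) − mass(H))/q)) ≤ q^m · exp((λ²/q) ∑_{x ∉ H} deg(x)²)`
  whenever `0 ≤ λ`, `2λ·deg(x) ≤ 1` off `H` (stub `monoMass_expMoment_var`): the variance proxy `4λ²∑deg²` of `expMoment_le`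
  becomes `(λ²/q)∑deg²` — the gain `4q ≈ 4k` that moves the first term of the catch bound from `exp(−Ω(m/(kL²)))` to
  `exp(−Ω(m/L²))`.
[new; elementary]
-/

set_option linter.dupNamespace false

namespace Summit.PneNP.PneNP.Theorems

open Finset Real

noncomputable section

/-! ## The variance one-step lemma -/

/-- **One step, variance form.** If `∑_i y_i = 0` and `|y_i| ≤ 1` then `∑_i e^{y_i} ≤ q · exp((∑_i y_i²)/q)` (from
`e^y ≤ 1 + y + y²` on `[-1, 1]` and `1 + s ≤ e^s`). [folklore] -/
theorem sum_exp_le_of_sum_eq_zero_var {q : ℕ} (y : Fin q → ℝ) (hy : ∀ i, |y i| ≤ 1) (h0 : ∑ i, y i = 0) :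
    ∑ i, Real.exp (y i) ≤ q * Real.exp ((∑ i, (y i) ^ 2) / q) := by
  rcases Nat.eq_zero_or_pos q with hq | hq
  · subst hq; simp
  have hqR : (0 : ℝ) < q := by exact_mod_cast hq
  have hpt : ∀ i, Real.exp (y i) ≤ 1 + y i + (y i) ^ 2 := by
    intro i
    have h2 := Real.abs_exp_sub_one_sub_id_le (hy i)
    have h4 := (abs_le.1 h2).2
    linarith
  calc ∑ i, Real.exp (y i) ≤ ∑ i, (1 + y i + (y i) ^ 2) := Finset.sum_le_sum fun i _ => hpt i
    _ = q * (1 + (∑ i, (y i) ^ 2) / q) := by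
        rw [Finset.sum_add_distrib, Finset.sum_add_distrib, h0, Finset.sum_const, Finset.card_univ, Fintype.card_fin,
          nsmul_eq_mul, add_zero, mul_add, mul_one, mul_div_cancel₀ _ hqR.ne']
    _ ≤ q * Real.exp ((∑ i, (y i) ^ 2) / q) := by
        gcongr
        linarith [Real.add_one_le_exp ((∑ i, (y i) ^ 2) / q)]

/-- **Sum of squared deviations from the mean is at most the product of the maximum and the sum of absolute values.**
If `|A_i| ≤ D` for all `i` and `∑_i |A_i| ≤ D` then `∑_i (A_i − Ā)² ≤ D²` (`Ā` the mean). [folklore] -/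
theorem sum_sq_sub_mean_le {q : ℕ} (hq : 0 < q) (A : Fin q → ℝ) {D : ℝ} (hmax : ∀ i, |A i| ≤ D)
    (hsum : ∑ i, |A i| ≤ D) : ∑ i, (A i - (∑ j, A j) / q) ^ 2 ≤ D ^ 2 := by
  have hqR : (0 : ℝ) < q := by exact_mod_cast hq
  have hD0 : 0 ≤ D := le_trans (Finset.sum_nonneg fun i _ => abs_nonneg (A i)) hsum
  -- `∑ (A_i − Ā)² = ∑ A_i² − q Ā² ≤ ∑ A_i²`
  have h1 : ∑ i, (A i - (∑ j, A j) / q) ^ 2 ≤ ∑ i, (A i) ^ 2 := by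
    have e : ∑ i, (A i - (∑ j, A j) / q) ^ 2 = ∑ i, (A i) ^ 2 - (∑ j, A j) ^ 2 / q := by
      have : ∀ i, (A i - (∑ j, A j) / q) ^ 2 = (A i) ^ 2 - 2 * ((∑ j, A j) / q) * A i + ((∑ j, A j) / q) ^ 2 := by
        intro i; ring
      simp_rw [this]
      rw [Finset.sum_add_distrib, Finset.sum_sub_distrib, ← Finset.mul_sum, Finset.sum_const, Finset.card_univ,
        Fintype.card_fin, nsmul_eq_mul]
      field_simp
      ring
    rw [e]
    have : 0 ≤ (∑ j, A j) ^ 2 / q := by positivity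
    linarith
  -- `∑ A_i² ≤ max|A_i| · ∑|A_i| ≤ D · D`
  have h2 : ∑ i, (A i) ^ 2 ≤ D * ∑ i, |A i| := by
    rw [Finset.mul_sum]
    refine Finset.sum_le_sum fun i _ => ?_
    rw [← sq_abs, sq]
    exact mul_le_mul_of_nonneg_right (hmax i) (abs_nonneg _)
  calc ∑ i, (A i - (∑ j, A j) / q) ^ 2 ≤ ∑ i, (A i) ^ 2 := h1
    _ ≤ D * ∑ i, |A i| := h2
    _ ≤ D * D := mul_le_mul_of_nonneg_left hsum hD0
    _ = D ^ 2 := by ring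

/-! ## Peeling one vertex, variance form -/

variable {m q : ℕ}

/-- **The one-vertex averaging step, variance form.** For `x ∉ S`, `0 < q`, `0 ≤ λ` and `2λ·deg(x) ≤ 1`:
`∑_i exp(λ(∑_{u ∈ S} V u x 𝟙[c u = i] − (∑_{u ∈ S} V u x)/q)) ≤ q · exp(λ² deg(x)² / q)`. [new; elementary] -/
theorem sum_exp_step_le_var (V : Fin m → Fin m → ℝ) (hV : ∀ x y, V x y = V y x) (hq : 0 < q) (c : Fin m → Fin q)
    {S : Finset (Fin m)} {x : Fin m} {lam : ℝ} (hlam : 0 ≤ lam) (hdeg : 2 * lam * ∑ y, |V x y| ≤ 1) :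
    ∑ i : Fin q, Real.exp (lam * ((∑ u ∈ S, if c u = i then V u x else 0) - (∑ u ∈ S, V u x) / q)) ≤
      q * Real.exp (lam ^ 2 * (∑ y, |V x y|) ^ 2 / q) := by
  classical
  have hq' : (q : ℝ) ≠ 0 := by exact_mod_cast hq.ne'
  have hq1 : (1 : ℝ) ≤ q := by exact_mod_cast hq
  set D : ℝ := ∑ y, |V x y| with hD
  have hD0 : 0 ≤ D := Finset.sum_nonneg fun y _ => abs_nonneg _
  -- the column sums into `S` are bounded by the degree
  have hS : ∑ u ∈ S, |V u x| ≤ D := by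
    calc ∑ u ∈ S, |V u x| = ∑ u ∈ S, |V x u| := Finset.sum_congr rfl fun u _ => by rw [hV u x]
      _ ≤ ∑ u, |V x u| := Finset.sum_le_sum_of_subset_of_nonneg (Finset.subset_univ _) fun u _ _ => abs_nonneg _
  have hA : ∀ i : Fin q, |∑ u ∈ S, (if c u = i then V u x else 0)| ≤ D := by
    intro i
    refine (Finset.abs_sum_le_sum_abs _ _).trans (le_trans (Finset.sum_le_sum fun u _ => ?_) hS)
    by_cases h : c u = i
    · rw [if_pos h]
    · rw [if_neg h, abs_zero]; exact abs_nonneg _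
  have hμ : |(∑ u ∈ S, V u x) / q| ≤ D := by
    rw [abs_div, abs_of_pos (by exact_mod_cast hq : (0 : ℝ) < q)]
    calc |∑ u ∈ S, V u x| / q ≤ |∑ u ∈ S, V u x| / 1 := by
          exact div_le_div_of_nonneg_left (abs_nonneg _) one_pos hq1
      _ ≤ D := by rw [div_one]; exact (Finset.abs_sum_le_sum_abs _ _).trans hS
  -- the increments `A_i`, their mean, and the variance bound
  set A : Fin q → ℝ := fun i => ∑ u ∈ S, (if c u = i then V u x else 0) with hAdef
  have h1 : ∀ u ∈ S, ∑ i : Fin q, (if c u = i then V u x else 0) = V u x := fun u _ => by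
    rw [Finset.sum_ite_eq, if_pos (Finset.mem_univ _)]
  have hsumA : ∑ i, A i = ∑ u ∈ S, V u x := by
    simp only [hAdef]
    rw [Finset.sum_comm]
    exact Finset.sum_congr rfl h1
  have hsumabs : ∑ i, |A i| ≤ D := by
    calc ∑ i, |A i| ≤ ∑ i, ∑ u ∈ S, |(if c u = i then V u x else 0)| :=
          Finset.sum_le_sum fun i _ => Finset.abs_sum_le_sum_abs _ _
      _ = ∑ u ∈ S, ∑ i, |(if c u = i then V u x else 0)| := Finset.sum_comm
      _ = ∑ u ∈ S, |V u x| := by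
          refine Finset.sum_congr rfl fun u _ => ?_
          have : ∀ i : Fin q, |(if c u = i then V u x else 0)| = if c u = i then |V u x| else 0 := by
            intro i; split_ifs <;> simp
          rw [Finset.sum_congr rfl (fun i _ => this i), Finset.sum_ite_eq, if_pos (Finset.mem_univ _)]
      _ ≤ D := hS
  have hvar := sum_sq_sub_mean_le hq A hA hsumabs
  rw [hsumA] at hvar
  -- apply the variance one-step lemma to `y_i = λ (A_i − Ā)`
  have key := sum_exp_le_of_sum_eq_zero_var
    (fun i : Fin q => lam * ((∑ u ∈ S, if c u = i then V u x else 0) - (∑ u ∈ S, V u x) / q)) ?_ ?_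
  · refine key.trans (mul_le_mul_of_nonneg_left (Real.exp_le_exp.2 ?_) (Nat.cast_nonneg _))
    refine div_le_div_of_nonneg_right ?_ (Nat.cast_nonneg _)
    have : ∀ i : Fin q, (lam * ((∑ u ∈ S, if c u = i then V u x else 0) - (∑ u ∈ S, V u x) / q)) ^ 2 =
        lam ^ 2 * ((A i) - (∑ u ∈ S, V u x) / q) ^ 2 := by intro i; simp only [hAdef]; ring
    simp_rw [this]
    rw [← Finset.mul_sum]
    exact mul_le_mul_of_nonneg_left hvar (sq_nonneg _)
  · intro i
    rw [abs_mul, abs_of_nonneg hlam]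
    calc lam * |(∑ u ∈ S, if c u = i then V u x else 0) - (∑ u ∈ S, V u x) / q|
        ≤ lam * (D + D) := by
          refine mul_le_mul_of_nonneg_left ((abs_sub _ _).trans (add_le_add (hA i) hμ)) hlam
      _ = 2 * lam * D := by ring
      _ ≤ 1 := hdeg
  · -- the increments have mean zero
    rw [← Finset.mul_sum, Finset.sum_sub_distrib, Finset.sum_comm]
    rw [Finset.sum_congr rfl h1, Finset.sum_const, Finset.card_univ, Fintype.card_fin, nsmul_eq_mul,
      mul_div_cancel₀ _ hq', sub_self, mul_zero]

/-! ## The exponential moment bound -/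

/-- **Exponential moment of the monochromatic mass, variance form (induction over the exposed set).** For `V` symmetric with zero
diagonal, `0 < q`, `0 ≤ λ`, a vertex set `H` and `2λ·deg(x) ≤ 1` for all `x ∉ H`: for every `s` disjoint from `H`,
`∑_c exp(λ·(M(H ∪ s, c) − M(H, c) − (mass(H ∪ s) − mass H)/q)) ≤ q^m · exp((λ²/q) ∑_{x ∈ s} deg(x)²)`. [new] -/
theorem expMoment_induction_var (V : Fin m → Fin m → ℝ) (hV : ∀ x y, V x y = V y x) (hV0 : ∀ x, V x x = 0)
    (hq : 0 < q) (H : Finset (Fin m)) {lam : ℝ} (hlam : 0 ≤ lam) (hdeg : ∀ x, x ∉ H → 2 * lam * ∑ y, |V x y| ≤ 1) :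
    ∀ s : Finset (Fin m), Disjoint s H →
      ∑ c : Fin m → Fin q, Real.exp (lam *
          ((∑ a ∈ H ∪ s, ∑ b ∈ H ∪ s, if c a = c b then V a b else 0) / 2 -
            (∑ a ∈ H, ∑ b ∈ H, if c a = c b then V a b else 0) / 2 -
            ((∑ a ∈ H ∪ s, ∑ b ∈ H ∪ s, V a b) / 2 - (∑ a ∈ H, ∑ b ∈ H, V a b) / 2) / q)) ≤
        (q : ℝ) ^ m * Real.exp (lam ^ 2 / q * ∑ x ∈ s, (∑ y, |V x y|) ^ 2) := by
  classical
  intro s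
  induction s using Finset.induction_on with
  | empty =>
    intro _
    simp only [Finset.union_empty, sub_self, zero_div, mul_zero, Real.exp_zero, Finset.sum_const, Finset.card_univ,
      Finset.sum_empty, mul_one, nsmul_eq_mul]
    rw [Fintype.card_fun, Fintype.card_fin, Fintype.card_fin]
    push_cast
    exact le_rfl
  | @insert x s hxs ih =>
    intro hdisj
    have hxH : x ∉ H := Finset.disjoint_left.1 hdisj (Finset.mem_insert_self x s)
    have hdisj' : Disjoint s H := Finset.disjoint_of_subset_left (Finset.subset_insert x s) hdisj
    have hx : x ∉ H ∪ s := by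
      rw [Finset.mem_union, not_or]; exact ⟨hxH, hxs⟩
    have hHs : H ∪ insert x s = insert x (H ∪ s) := by
      rw [Finset.union_insert]
    rw [hHs]
    -- peel `x`
    have hM : ∀ c : Fin m → Fin q,
        (∑ a ∈ insert x (H ∪ s), ∑ b ∈ insert x (H ∪ s), if c a = c b then V a b else 0) / 2 =
          (∑ a ∈ H ∪ s, ∑ b ∈ H ∪ s, if c a = c b then V a b else 0) / 2 +
            ∑ u ∈ H ∪ s, (if c u = c x then V u x else 0) := fun c => monoMass_insert V hV hV0 c hx
    have hm := mass_insert V hV hV0 hx (S := H ∪ s)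
    simp_rw [hM]
    rw [hm]
    -- rewrite the exponent as `old c + new c`
    set old : (Fin m → Fin q) → ℝ := fun c => lam *
        ((∑ a ∈ H ∪ s, ∑ b ∈ H ∪ s, if c a = c b then V a b else 0) / 2 -
          (∑ a ∈ H, ∑ b ∈ H, if c a = c b then V a b else 0) / 2 -
          ((∑ a ∈ H ∪ s, ∑ b ∈ H ∪ s, V a b) / 2 - (∑ a ∈ H, ∑ b ∈ H, V a b) / 2) / q) with hold
    set new : (Fin m → Fin q) → ℝ := fun c => lam *
        ((∑ u ∈ H ∪ s, if c u = c x then V u x else 0) - (∑ u ∈ H ∪ s, V u x) / q) with hnew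
    have hsplit : ∀ c : Fin m → Fin q, Real.exp (lam *
        ((∑ a ∈ H ∪ s, ∑ b ∈ H ∪ s, if c a = c b then V a b else 0) / 2 +
              ∑ u ∈ H ∪ s, (if c u = c x then V u x else 0) -
            (∑ a ∈ H, ∑ b ∈ H, if c a = c b then V a b else 0) / 2 -
            ((∑ a ∈ H ∪ s, ∑ b ∈ H ∪ s, V a b) / 2 + ∑ u ∈ H ∪ s, V u x -
              (∑ a ∈ H, ∑ b ∈ H, V a b) / 2) / q)) = Real.exp (old c) * Real.exp (new c) := by
      intro c
      rw [← Real.exp_add]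
      congr 1
      simp only [hold, hnew]
      ring
    simp_rw [hsplit]
    -- re-randomise the colour of `x`
    rw [sum_eq_sum_sum_update_div hq (fun c => Real.exp (old c) * Real.exp (new c)) x]
    have hold_upd : ∀ (c : Fin m → Fin q) (i : Fin q), old (Function.update c x i) = old c := by
      intro c i
      simp only [hold]
      rw [monoMass_update_of_notMem V c hx, monoMass_update_of_notMem V c hxH]
    have hnew_upd : ∀ (c : Fin m → Fin q) (i : Fin q), new (Function.update c x i) =
        lam * ((∑ u ∈ H ∪ s, if c u = i then V u x else 0) - (∑ u ∈ H ∪ s, V u x) / q) := by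
      intro c i
      simp only [hnew, Function.update_self]
      congr 1
      congr 1
      refine Finset.sum_congr rfl fun u hu => ?_
      rw [Function.update_of_ne (ne_of_mem_of_not_mem hu hx)]
    simp_rw [hold_upd, hnew_upd, ← Finset.mul_sum]
    -- the one-vertex step
    have hstep : ∀ c : Fin m → Fin q,
        Real.exp (old c) * ∑ i : Fin q, Real.exp (lam * ((∑ u ∈ H ∪ s, if c u = i then V u x else 0) -
            (∑ u ∈ H ∪ s, V u x) / q)) ≤
          Real.exp (old c) * (q * Real.exp (lam ^ 2 * (∑ y, |V x y|) ^ 2 / q)) := fun c =>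
      mul_le_mul_of_nonneg_left (sum_exp_step_le_var V hV hq c hlam (hdeg x hxH)) (Real.exp_pos _).le
    have hq' : (0 : ℝ) < q := by exact_mod_cast hq
    calc (∑ c : Fin m → Fin q, Real.exp (old c) *
            ∑ i : Fin q, Real.exp (lam * ((∑ u ∈ H ∪ s, if c u = i then V u x else 0) -
              (∑ u ∈ H ∪ s, V u x) / q))) / q
        ≤ (∑ c : Fin m → Fin q, Real.exp (old c) * (q * Real.exp (lam ^ 2 * (∑ y, |V x y|) ^ 2 / q))) / q :=
          div_le_div_of_nonneg_right (Finset.sum_le_sum fun c _ => hstep c) hq'.le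
      _ = Real.exp (lam ^ 2 * (∑ y, |V x y|) ^ 2 / q) * ∑ c : Fin m → Fin q, Real.exp (old c) := by
          rw [← Finset.sum_mul]
          field_simp
      _ ≤ Real.exp (lam ^ 2 * (∑ y, |V x y|) ^ 2 / q) *
            ((q : ℝ) ^ m * Real.exp (lam ^ 2 / q * ∑ x ∈ s, (∑ y, |V x y|) ^ 2)) :=
          mul_le_mul_of_nonneg_left (ih hdisj') (Real.exp_pos _).le
      _ = (q : ℝ) ^ m * Real.exp (lam ^ 2 / q * ∑ x ∈ insert x s, (∑ y, |V x y|) ^ 2) := by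
          rw [Finset.sum_insert hxs, mul_add, Real.exp_add]
          have e : lam ^ 2 * (∑ y, |V x y|) ^ 2 / q = lam ^ 2 / q * (∑ y, |V x y|) ^ 2 := by ring
          rw [e]
          ring

/-- **Exponential moment of the monochromatic mass, variance form** (all non-hub vertices exposed): for `V` symmetric with zero
diagonal, `0 < q`, `0 ≤ λ` and `2λ·deg(x) ≤ 1` off `H`,
`∑_c exp(λ·(M(univ,c) − M(H,c) − (mass(univ) − mass H)/q)) ≤ q^m · exp((λ²/q) ∑_{x ∉ H} deg(x)²)`. [new] -/
theorem expMoment_le_var (V : Fin m → Fin m → ℝ) (hV : ∀ x y, V x y = V y x) (hV0 : ∀ x, V x x = 0)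
    (hq : 0 < q) (H : Finset (Fin m)) {lam : ℝ} (hlam : 0 ≤ lam) (hdeg : ∀ x, x ∉ H → 2 * lam * ∑ y, |V x y| ≤ 1) :
    ∑ c : Fin m → Fin q, Real.exp (lam *
        ((∑ a, ∑ b, if c a = c b then V a b else 0) / 2 -
          (∑ a ∈ H, ∑ b ∈ H, if c a = c b then V a b else 0) / 2 -
          ((∑ a, ∑ b, V a b) / 2 - (∑ a ∈ H, ∑ b ∈ H, V a b) / 2) / q)) ≤
      (q : ℝ) ^ m * Real.exp (lam ^ 2 / q * ∑ x ∈ Hᶜ, (∑ y, |V x y|) ^ 2) := by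
  have h := expMoment_induction_var V hV hV0 hq H hlam hdeg Hᶜ disjoint_compl_left
  rw [Finset.union_compl] at h
  exact h

/-- **Exponential moment of the monochromatic mass, variance form** (registered form of `expMoment_le_var`). [new] -/
theorem monoMass_expMoment_var : ∀ {m q : ℕ} (V : Fin m → Fin m → ℝ), (∀ x y, V x y = V y x) → (∀ x, V x x = 0) → 0 < q → ∀ (H : Finset (Fin m)) (lam : ℝ), 0 ≤ lam → (∀ x, x ∉ H → 2 * lam * ∑ y, |V x y| ≤ 1) → ∑ c : Fin m → Fin q, Real.exp (lam * ((∑ a, ∑ b, if c a = c b then V a b else 0) / 2 - (∑ a ∈ H, ∑ b ∈ H, if c a = c b then V a b else 0) / 2 - ((∑ a, ∑ b, V a b) / 2 - (∑ a ∈ H, ∑ b ∈ H, V a b) / 2) / q)) ≤ (q : ℝ) ^ m * Real.exp (lam ^ 2 / q * ∑ x ∈ Hᶜ, (∑ y, |V x y|) ^ 2) :=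
  fun V hV hV0 hq H _ hlam hdeg => expMoment_le_var V hV hV0 hq H hlam hdeg

end

end Summit.PneNP.PneNP.Theorems
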